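import Summits.ABC.ABC.Theses.IsogenyGlueCongruence
import Summits.ABC.ABC.Theorems.MazurKenkuBound.Negative.StrongForm
import Literature.NumberTheory.EllipticCurves.LatticeMultiplierIndex
import Literature.NumberTheory.EllipticCurves.NeronIsogenyScaling
import HarnessLib

/-!
# `MazurKenkuBound` (stmt-ABC-15125) · Negative · necessity: the crux contains a fragment of
# Edixhoven's integrality at every prime

Necessity-side knowledge for the crux `Summit.ABC.ABC.Theses.IsogenyGlueCongruence.MazurKenkuBound`
(line `Sketch`, lead c15, cycle 16, 2026-08-16). Sorry-free; no theorem asserts a Theses decl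
positively.

The crux is, by the landed `mazurKenkuBound_iff_hMK` (`StrongForm.lean`), the statement: for every
GLOBALLY MINIMAL parametrised `W'` with newform `f` there is an integer `k ≠ 0` with `kΛ_f ⊆ Λ_{W'}`
of index `[Λ_{W'} : kΛ_f] ≤ 163`. Its forward direction is the Mazur–Kenku radius for the primitive
rational-scalar isogeny `E_f → W'`. This file isolates the OTHER printed input inside the crux:
specialised to a globally minimal `W₀` whose Néron lattice is EXACTLY `q₀Λ_f` for a rational `q₀`
(so `W₀` is a minimal model of the strong Weil curve `E_f` and `|q₀|` is its Manin constant — the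
situation of Edixhoven 1991, Prop. 2, i.e. of the sibling crux item `EdixhovenIntegrality`,
stmt-ABC-15990, which asserts `q₀ ∈ ℤ`), the crux forces `(den q₀)² ≤ 163`, i.e. `den q₀ ≤ 12`:

* `sq_le_natCard_ker_mulQuotientMap` — index tool for a general multiplier `k` (companion of
  `LoadBearing.sq_le_natCard_ker_isogenyMap`, which is the case `k = D.c`): if `k⁻¹l ∈ Λ_f` forces
  `l ∈ nΛ_E`, then `n² = [Λ_E : nΛ_E] ≤ #ker(z ↦ kz : ℂ/Λ_f → ℂ/Λ_E)`.
* `den_sq_le_of_mazurKenkuBound` — `MazurKenkuBound →` for every datum `D₀` of a globally minimal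
  `W₀` and `q₀ ∈ ℚ` with `Λ_{W₀} = q₀Λ_f` (both inclusions, verbatim the hypotheses of
  `edixhoven_int_of_neronLattice_eq_smul_periodLattice`), `q₀.den ^ 2 ≤ 163`. Proof: the integer
  `k` of hMK satisfies `(k/q₀)Λ_{W₀} ⊆ Λ_{W₀}`, so `k = nq₀` with `n ∈ ℤ`
  (`int_of_rat_mul_mem_lattice_self`), `den q₀ ∣ n`, and `#ker(z ↦ kz) = [q₀Λ_f : nq₀Λ_f] = n²`.

Consequence for planning (D-0021 BARRIERS): any proof of the crux bounds the denominator of the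
Manin constant of the strong Weil curve at EVERY prime, the additive primes `2, 3` included — exactly
the primes the tree's analytic (Honda-type) Manin-constant programme does not reach (census in
`Literature/NumberTheory/EllipticCurves/NeronIsogenyScaling.lean`: good and multiplicative `p ≥ 5`
proved). Together with the forward direction of `mazurKenkuBound_iff_hMK` this is the kernel-checked
form of "no re-lining of stmt-ABC-15125 is cheaper than its two inputs stmt-ABC-15193 and
stmt-ABC-15990 (up to the exponent `den q₀ ≤ 12` versus `den q₀ = 1`)".

## References

* B. Edixhoven, *On the Manin constants of modular elliptic curves*, in: Arithmetic Algebraic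
  Geometry (Texel 1989), Progr. Math. 89 (1991), 25–39: Prop. 2. [EdixhovenManin1991]
* A. Agashe, K. Ribet, W. A. Stein, *The Manin constant*, Pure Appl. Math. Q. 2 (2006), 617–636:
  Thm. 2.2. [AgasheRibetStein2006]
* H. Pasten, *Shimura curves and the abc conjecture*, J. Number Theory 254 (2024), 214–335: §3 p. 13.
  [PastenShimura2024]
* J. H. Silverman, *The Arithmetic of Elliptic Curves*, 2nd ed., GTM 106 (2009): Thm. VI.4.1,
  III.4.10(c). [SilvermanAEC2009]
-/

-- `Summit.ABC.ABC` is the mandated summit-side namespace (CONVENTIONS §2); the duplicate is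
-- deliberate.
set_option linter.dupNamespace false

noncomputable section

namespace Summit.ABC.ABC.Theorems.MazurKenkuBound.Negative

open Literature.NumberTheory.EllipticCurves
open Literature.NumberTheory.EllipticCurves.ModularForms
open Summit.ABC.ABC.Theses.IsogenyGlueCongruence
open scoped MatrixGroups ModularForm
open CongruenceSubgroup

/-! ### The index tool for a general multiplier -/

/-- **Kernel lower bound for `z ↦ kz`.** Let `D` be a parametrisation datum (`Λ_f`, `Λ_E`), `k ≠ 0`
a complex multiplier with `kΛ_f ⊆ Λ_E`, and `n ≠ 0` an integer such that `k⁻¹l ∈ Λ_f` forces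
`l ∈ nΛ_E` for `l ∈ Λ_E` (the kernel `k⁻¹Λ_E/Λ_f` of `z ↦ kz : ℂ/Λ_f → ℂ/Λ_E` receives
`Λ_E/nΛ_E` injectively via `l ↦ k⁻¹l`). Then `n² = [Λ_E : nΛ_E] ≤ #ker(z ↦ kz)` (the kernel is
finite because `Λ_f` is a full lattice, `finite_ker_mulQuotientMap`; `[Λ : nΛ] = n n̄ = n²` is the
tree's `PeriodPair.natCard_quotient_range_mulLeft`). Companion of
`LoadBearing.sq_le_natCard_ker_isogenyMap` (the case `k = D.c`). [cite: SilvermanAEC2009, Thm. VI.4.1 and III.4.10(c)] -/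
theorem sq_le_natCard_ker_mulQuotientMap {N : ℕ} [NeZero N] {W : WeierstrassCurve ℚ}
    (D : ModularParametrizationData W N) {k : ℂ}
    (hk : ∀ z ∈ periodLattice D.f, k * z ∈ D.L.lattice) (hk0 : k ≠ 0) {n : ℤ} (hn : n ≠ 0)
    (h_out : ∀ l ∈ D.L.lattice, k⁻¹ * l ∈ periodLattice D.f →
      ∃ l' ∈ D.L.lattice, l = (n : ℂ) * l') :
    n.natAbs ^ 2 ≤
      Nat.card (mulQuotientMap (periodLattice D.f) D.L.lattice.toAddSubgroup k hk).ker := by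
  have hf0 : D.f ≠ 0 := D.isNewformOf.1.ne_zero
  haveI := discreteTopology_periodLattice_of_mul_mem D.f D.cast_c_ne_zero D.smul_periodLattice_le
  obtain ⟨b, hb⟩ := exists_basis_span_eq_periodLattice D.f hf0
  set m := mulQuotientMap (periodLattice D.f) D.L.lattice.toAddSubgroup k hk with hm
  haveI hfin : Finite m.ker := finite_ker_mulQuotientMap b hb D.L hk hk0
  have hn0 : (n : ℂ) ≠ 0 := Int.cast_ne_zero.mpr hn
  -- `ψ : Λ_E → ℂ/Λ_f`, `l ↦ k⁻¹ l`
  set ψ : D.L.lattice →+ ℂ ⧸ periodLattice D.f :=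
    (QuotientAddGroup.mk' (periodLattice D.f)).comp
      ((AddMonoidHom.mulLeft k⁻¹).comp D.L.lattice.subtype.toAddMonoidHom) with hψ
  have hψ_apply : ∀ l : D.L.lattice, ψ l = ((k⁻¹ * (l : ℂ) : ℂ) : ℂ ⧸ periodLattice D.f) :=
    fun _ ↦ rfl
  -- its range lies in the kernel of `z ↦ kz`
  have hrange : ψ.range ≤ m.ker := by
    rintro _ ⟨l, rfl⟩
    rw [AddMonoidHom.mem_ker, hψ_apply, hm, mulQuotientMap_mk, mul_inv_cancel_left₀ hk0,
      QuotientAddGroup.eq_zero_iff]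
    exact l.2
  -- its kernel lies in `n Λ_E`
  have hα : ∀ l ∈ D.L.lattice, (n : ℂ) * l ∈ D.L.lattice := fun l hl ↦ by
    simpa [zsmul_eq_mul] using zsmul_mem hl n
  set Nk : Submodule ℤ D.L.lattice := LinearMap.range ((LinearMap.mulLeft ℤ (n : ℂ)).restrict hα)
    with hNk
  have hker : ψ.ker ≤ Nk.toAddSubgroup := by
    intro l hl
    rw [AddMonoidHom.mem_ker, hψ_apply, QuotientAddGroup.eq_zero_iff] at hl
    obtain ⟨l', hl', hll'⟩ := h_out l l.2 hl
    rw [Submodule.mem_toAddSubgroup, hNk, PeriodPair.mem_range_restrict_mulLeft_iff]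
    exact ⟨l', hl', hll'⟩
  -- `[Λ_E : n Λ_E] = n²`
  have hidx : Nk.toAddSubgroup.index = n.natAbs ^ 2 := by
    have h := D.L.natCard_quotient_range_mulLeft hα hn0
    rw [map_intCast] at h
    have hsq : (((n.natAbs ^ 2 : ℕ) : ℤ) : ℂ) = (n : ℂ) * n := by
      rw [Nat.cast_pow, Int.natAbs_sq, Int.cast_pow, sq]
    have h' : ((Nat.card (D.L.lattice ⧸ Nk) : ℕ) : ℂ) = ((n.natAbs ^ 2 : ℕ) : ℂ) := by
      rw [hNk, h, ← Int.cast_natCast (R := ℂ) (n.natAbs ^ 2), hsq]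
    exact_mod_cast h'
  -- count
  have hfinR : Finite ψ.range :=
    Finite.of_injective _ (AddSubgroup.inclusion_injective hrange)
  have hpos : 0 < Nat.card ψ.range := Nat.card_pos
  have hdvd : n.natAbs ^ 2 ∣ Nat.card ψ.range := by
    rw [← AddSubgroup.index_ker ψ, ← hidx]
    exact AddSubgroup.index_dvd_of_le hker
  exact (Nat.le_of_dvd hpos hdvd).trans (AddSubgroup.card_le_of_le hrange)

/-! ### The crux bounds the denominator of the Manin constant of the strong Weil curve -/

/-- **Necessity (N1): `MazurKenkuBound` contains a fragment of Edixhoven's Prop. 2 at every prime.**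
Assume the crux. Let `W₀/ℚ` be globally minimal with a parametrisation datum `D₀` (newform `f`,
Néron lattice `Λ_{W₀}`) and let `q₀ ∈ ℚ` satisfy `Λ_{W₀} = q₀Λ_f` (both inclusions — verbatim the
hypotheses of `edixhoven_int_of_neronLattice_eq_smul_periodLattice`, so `W₀` is a minimal model of
the strong Weil curve `E_f` and `|q₀|` its Manin constant). Then `(den q₀)² ≤ 163` (so
`den q₀ ≤ 12`): by `mazurKenkuBound_iff_hMK` there is an integer `k ≠ 0` with `kΛ_f ⊆ Λ_{W₀}` and
`#ker(z ↦ kz) ≤ 163`; then `(k/q₀)Λ_{W₀} ⊆ Λ_{W₀}`, so `k = nq₀` with `n ∈ ℤ ∖ {0}`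
(`int_of_rat_mul_mem_lattice_self`), `q₀ = k/n` has `den q₀ ∣ n`, and
`#ker(z ↦ kz) = [q₀Λ_f : nq₀Λ_f] ≥ n²` (`sq_le_natCard_ker_mulQuotientMap`). Edixhoven's
Prop. 2 is the sharper `den q₀ = 1`; the point is that the crux already controls `den q₀` at the
additive primes `2, 3`, where no analytic route of the tree reaches.
[cite: EdixhovenManin1991, Prop. 2] [cite: AgasheRibetStein2006, Thm. 2.2]
[cite: PastenShimura2024, §3 p. 13] -/
theorem den_sq_le_of_mazurKenkuBound (h : MazurKenkuBound) {N : ℕ} [NeZero N]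
    {W₀ : WeierstrassCurve ℚ} [W₀.IsElliptic] [W₀.IsGloballyMinimal]
    (D₀ : ModularParametrizationData W₀ N) (q₀ : ℚ)
    (h₁ : ∀ z ∈ periodLattice D₀.f, (q₀ : ℂ) * z ∈ D₀.L.lattice)
    (h₂ : ∀ z ∈ D₀.L.lattice, ∃ w ∈ periodLattice D₀.f, z = q₀ * w) :
    q₀.den ^ 2 ≤ 163 := by
  obtain ⟨k, hk, hk0, hcard⟩ := mazurKenkuBound_iff_hMK.mp h D₀
  -- `q₀ ≠ 0`: the Néron lattice is not zero
  have hq0 : q₀ ≠ 0 := by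
    intro hq
    obtain ⟨w, -, hw⟩ := h₂ _ D₀.L.ω₁_mem_lattice
    have hω : D₀.L.ω₁ ≠ 0 := by
      have := D₀.L.indep.ne_zero 0
      simpa using this
    rw [hq, Rat.cast_zero, zero_mul] at hw
    exact hω hw
  have hq0' : (q₀ : ℂ) ≠ 0 := by exact_mod_cast hq0
  -- `r := k / q₀` maps `Λ_{W₀}` into itself, hence is an integer `n`
  have hr : ∀ z ∈ D₀.L.lattice, (((k : ℚ) / q₀ : ℚ) : ℂ) * z ∈ D₀.L.lattice := by
    intro z hz
    obtain ⟨w, hw, rfl⟩ := h₂ z hz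
    have : (((k : ℚ) / q₀ : ℚ) : ℂ) * ((q₀ : ℂ) * w) = (k : ℂ) * w := by
      push_cast
      field_simp
    rw [this]
    exact hk w hw
  obtain ⟨n, hn⟩ := int_of_rat_mul_mem_lattice_self D₀.L _ hr
  have hkq : (k : ℚ) = n * q₀ := by
    rw [hn, div_mul_cancel₀ _ hq0]
  have hn0 : n ≠ 0 := by
    rintro rfl
    rw [Int.cast_zero, zero_mul, Int.cast_eq_zero] at hkq
    exact hk0 hkq
  -- `den q₀ ∣ n`
  have hden : q₀.den ≤ n.natAbs := by
    have hq : q₀ = Rat.divInt k n := by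
      rw [Rat.divInt_eq_div, hkq, mul_div_cancel_left₀ _ (Int.cast_ne_zero.mpr hn0)]
    have hd : (q₀.den : ℤ) ∣ n := hq ▸ Rat.den_dvd k n
    exact Nat.le_of_dvd (Int.natAbs_pos.mpr hn0) (Int.natAbs_dvd_natAbs.mpr hd)
  -- `#ker(z ↦ kz) ≥ n²`
  have hkC : ((k : ℂ)) = (n : ℂ) * (q₀ : ℂ) := by
    have := congrArg (fun x : ℚ ↦ (x : ℂ)) hkq
    push_cast at this
    exact this
  have hk0' : (k : ℂ) ≠ 0 := by exact_mod_cast hk0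
  have hker := sq_le_natCard_ker_mulQuotientMap D₀ hk hk0' hn0 (fun l hl hlf ↦ by
    refine ⟨(q₀ : ℂ) * ((k : ℂ)⁻¹ * l), h₁ _ hlf, ?_⟩
    rw [← mul_assoc, ← hkC, mul_inv_cancel_left₀ hk0'])
  calc q₀.den ^ 2 ≤ n.natAbs ^ 2 := Nat.pow_le_pow_left hden 2
    _ ≤ _ := hker
    _ ≤ 163 := hcard

end Summit.ABC.ABC.Theorems.MazurKenkuBound.Negative

end
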